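import Summits.Ventures.PercRepro.C025ProfileGirthSuccSuccPairInj
import Summits.Ventures.PercRepro.C025ProfileGirthSuccSuccPairCount

/-!
# THE ROW `(q, q+2)` AT GIRTH `≥ q+1` — THE FAT SETS ARE PAID BY THEIR PAIR SETS, AND THE ROW FROM (T2′) (night-3 g20)

* `regimeA_of_pairs`, `regimeB_of_pairs`, **`choose_two_le_of_pairs`** — the arithmetic: from `P ≥ s − 1` and
  `2P ≥ s(s − q − 1)` with `3 ≤ s`, `p ≤ s + q`, `q ≥ 1`: `C(p, 2) ≤ C(q+2, 2) · P` (for `s ≤ 2q + 1` the linear bound,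
  for `s ≥ 2q + 2` the quadratic one);
* **`price_le_card_pairs`** — `price(X) ≤ #{pair sets of X}` for every rank-`q` set `X` (rank `≥ q + 3`, `q ≥ 1`);
* **`fatIneq_of_girth`** (T3) — `Σ_{B ∈ Rq, #B ≠ q} price(B) ≤ #{S : ρ(S) = q + 2, S not clean}`: the pair sets of
  distinct fat sets are distinct non-clean level sets (companion modules);
* **`profileIneq_succ_succ_of_thin`** — THE ROW `(q, q+2)` OF (Π) (C-032) AT GIRTH `≥ q + 1` FROM (T2′) ALONE:
  `Σ_{B ∈ Rq, #B = q} price(B) ≤ #{clean (q+2)-subsets}` gives `Profile.ProfileIneq M q (q + 2)` (rank `≥ q + 3`,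
  `q ≥ 1`); with the companion decomposition module the row is now reduced to the thin sets against the clean sets.
Own data: (T2′) holds with `0` violations on every matroid of girth `≥ q + 1` and rank `≥ q + 3` on `≤ 9` points
(`q = 2`: 190,400; `q = 3`: 1,005), on the direct sums `U_{q,N} ⊕ U_{f,f}` up to 13 points (`q ≤ 4`, often with
equality) and on random linear matroids with planted fat flats up to 12 points, together with its Hall form (max-flow).
No `def`, no `instance`, no notation.  Axioms: standard.
-/

open scoped Matroid

namespace PercRepro

open Set Finset ThmH Staged

namespace GirthRows

variable {α : Type} [DecidableEq α] {M : Matroid α} [M.Finite]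

section Arith

/-- regime A: `3 ≤ s ≤ 2q+1`, `q ≥ 1`: `(s+q)(s+q−1) ≤ (q+2)(q+1)(s−1)` in ℚ. -/
theorem regimeA_of_pairs (q s : ℚ) (hq : 1 ≤ q) (hs3 : 3 ≤ s) (hs : s ≤ 2 * q + 1) :
    (s + q) * (s + q - 1) ≤ (q + 2) * (q + 1) * (s - 1) := by
  nlinarith [mul_nonneg (sub_nonneg.2 hs3) (sub_nonneg.2 hs), mul_nonneg (sub_nonneg.2 hq) (sub_nonneg.2 hs3),
    mul_nonneg (sub_nonneg.2 hq) (sub_nonneg.2 hs), mul_nonneg (sub_nonneg.2 hq) (sub_nonneg.2 hq),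
    mul_nonneg (mul_nonneg (sub_nonneg.2 hq) (sub_nonneg.2 hq)) (sub_nonneg.2 hs3)]

/-- regime B: `s ≥ 2q+2`, `q ≥ 1`: `2(s+q)(s+q−1) ≤ (q+2)(q+1) s (s−q−1)`. -/
theorem regimeB_of_pairs (q s : ℚ) (hq : 1 ≤ q) (hs : 2 * q + 2 ≤ s) :
    2 * ((s + q) * (s + q - 1)) ≤ (q + 2) * (q + 1) * (s * (s - q - 1)) := by
  nlinarith [mul_nonneg (sub_nonneg.2 hs) (sub_nonneg.2 hs), mul_nonneg (sub_nonneg.2 hq) (sub_nonneg.2 hs),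
    mul_nonneg (sub_nonneg.2 hq) (sub_nonneg.2 hq), mul_nonneg (mul_nonneg (sub_nonneg.2 hq) (sub_nonneg.2 hq)) (sub_nonneg.2 hs),
    mul_nonneg (mul_nonneg (sub_nonneg.2 hq) (sub_nonneg.2 hs)) (sub_nonneg.2 hs),
    mul_nonneg (mul_nonneg (sub_nonneg.2 hq) (sub_nonneg.2 hq)) (mul_nonneg (sub_nonneg.2 hs) (sub_nonneg.2 hs))]

/-- the arithmetic of the pair count: `C(p,2) ≤ C(q+2,2) · P` from `P ≥ s − 1`, `2P ≥ s(s−q−1)`, `3 ≤ s`, `p ≤ s + q`, `q ≥ 1`. -/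
theorem choose_two_le_of_pairs {p q s P : ℕ} (hq : 1 ≤ q) (hs3 : 3 ≤ s) (hps : p ≤ s + q)
    (hA : s - 1 ≤ P) (hB : s * (s - q - 1) ≤ 2 * P) : p.choose 2 ≤ (q + 2).choose 2 * P := by
  have hpq : ((p.choose 2 : ℕ) : ℚ) ≤ (((q + 2).choose 2 : ℕ) : ℚ) * P := by
    rw [Nat.cast_choose_two, Nat.cast_choose_two]
    push_cast
    have hqQ : (1 : ℚ) ≤ q := by exact_mod_cast hq
    have hsQ : (3 : ℚ) ≤ s := by exact_mod_cast hs3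
    have hpsQ : (p : ℚ) ≤ s + q := by exact_mod_cast hps
    have hAQ : (s : ℚ) - 1 ≤ P := by
      have : ((s - 1 : ℕ) : ℚ) ≤ P := by exact_mod_cast hA
      rw [Nat.cast_sub (by omega)] at this
      simpa using this
    have hBQ : (s : ℚ) * (s - q - 1) ≤ 2 * P := by
      have h1 : ((s * (s - q - 1) : ℕ) : ℚ) ≤ 2 * P := by exact_mod_cast hB
      rcases Nat.lt_or_ge s (q + 2) with hlt | hge
      · have : (s : ℚ) - q - 1 ≤ 0 := by
          have : s ≤ q + 1 := by omega
          have : (s : ℚ) ≤ q + 1 := by exact_mod_cast this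
          linarith
        have hP : (0 : ℚ) ≤ P := by exact_mod_cast Nat.zero_le P
        nlinarith
      · have : ((s * (s - q - 1) : ℕ) : ℚ) = (s : ℚ) * (s - q - 1) := by
          rw [Nat.cast_mul, Nat.cast_sub (by omega), Nat.cast_sub (by omega)]
          push_cast
          ring
        rw [this] at h1
        exact h1
    have hp0 : (0 : ℚ) ≤ p := by exact_mod_cast Nat.zero_le p
    have hpp : (p : ℚ) * (p - 1) ≤ (s + q) * (s + q - 1) := by
      have h0 : (0 : ℚ) ≤ (s + q) - p := by linarith
      nlinarith
    rcases le_or_gt s (2 * q + 1) with hsA | hsB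
    · have hsAQ : (s : ℚ) ≤ 2 * q + 1 := by exact_mod_cast hsA
      have := regimeA_of_pairs q s hqQ hsQ hsAQ
      have hq2 : (0 : ℚ) ≤ (q + 2) * (q + 1) := by positivity
      calc (p : ℚ) * (p - 1) / 2 ≤ (q + 2) * (q + 1) * (s - 1) / 2 := by linarith
        _ ≤ (q + 2) * (q + 1) * P / 2 := by
            apply div_le_div_of_nonneg_right _ (by norm_num)
            exact mul_le_mul_of_nonneg_left hAQ hq2
        _ = ((q : ℚ) + 2) * ((q : ℚ) + 2 - 1) / 2 * P := by ring
    · have hsBQ : 2 * (q : ℚ) + 2 ≤ s := by exact_mod_cast (show 2 * q + 2 ≤ s by omega)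
      have := regimeB_of_pairs q s hqQ hsBQ
      have hq2 : (0 : ℚ) ≤ (q + 2) * (q + 1) := by positivity
      calc (p : ℚ) * (p - 1) / 2 ≤ (q + 2) * (q + 1) * (s * (s - q - 1)) / 4 := by linarith
        _ ≤ (q + 2) * (q + 1) * (2 * P) / 4 := by
            apply div_le_div_of_nonneg_right _ (by norm_num)
            exact mul_le_mul_of_nonneg_left hBQ hq2
        _ = ((q : ℚ) + 2) * ((q : ℚ) + 2 - 1) / 2 * P := by ring
  exact_mod_cast hpq


end Arith

open scoped Classical in
/-- **The fat price is at most the number of pair sets**: for a rank-`q` set `X ⊆ E` at girth `≥ q + 1`, rank `≥ q + 3`,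
`q ≥ 1`: `price(X) ≤ #{Y ⊆ E ∖ X : |Y| = 2, ρ(X ∪ Y) = q + 2}`.  With `p = ρ(E ∖ X)`, a basis of `E ∖ X` has `s ≥ p − q`
points outside `cl X` (`card_filter_mem_closure_le`), `s ≥ 3` (`rkN_union_filter_notMem_closure`), and the pair count is at
least `max(s − 1, s(s − q − 1)/2)` (`card_sub_one_le_card_pairs`, `mul_le_two_mul_card_pairs`); `choose_two_le_of_pairs`
and `choose_succ_succ_mul_choose_two` turn this into `C(p+q, q+2)/C(p+q, q) ≤ #pairs`. -/
theorem price_le_card_pairs {q : ℕ} (hq : 1 ≤ q) (hrank : ((q + 3 : ℕ) : ℕ∞) ≤ M.eRank) {X : Finset α}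
    (hXg : X ⊆ gr M) (hXr : rkN M X = q) :
    Profile.price M q (q + 2) X ≤
      ((((gr M \ X).powersetCard 2).filter (fun Y => rkN M (X ∪ Y) = q + 2)).card : ℚ) := by
  set PS := ((gr M \ X).powersetCard 2).filter (fun Y => rkN M (X ∪ Y) = q + 2) with hPS
  set p := rkN M (gr M \ X) with hp
  have hpdef : (M.eRk ((gr M \ X : Finset α) : Set α)).toNat = p := rfl
  unfold Profile.price
  split_ifs with hthr
  · rw [hpdef]
    -- `p ≥ q + 2`
    have hpq : q + 2 ≤ p := by
      have h := hthr
      rw [← Staged.coe_rkN] at h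
      exact_mod_cast h
    -- the basis
    obtain ⟨Z, hZg, hZi, hZc, hZcl⟩ := exists_basis_finset_sdiff (M := M) X
    set Z' := Z.filter (fun z => z ∉ M.closure (X : Set α)) with hZ'
    have hZ'g : Z' ⊆ gr M \ X := (Finset.filter_subset _ _).trans hZg
    have hZ'i : M.Indep (Z' : Set α) := hZi.subset (Finset.coe_subset.2 (Finset.filter_subset _ _))
    have hZ'c : ∀ z ∈ Z', z ∉ M.closure (X : Set α) := fun z hz => (Finset.mem_filter.1 hz).2
    -- `s ≥ p − q`
    have hZ1 := card_filter_mem_closure_le (A := X) hZi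
    rw [hXr] at hZ1
    have hsplit := Finset.card_filter_add_card_filter_not (fun z => z ∈ M.closure (X : Set α)) (s := Z)
    have hsZ : p ≤ Z'.card + q := by
      rw [hZ']
      omega
    -- `ρ(X ∪ Z') = ρ(E) ≥ q + 3`
    have hrkE : q + 3 ≤ rkN M (gr M) := by
      have h := hrank
      rw [Matroid.eRank_def, ← coe_gr, ← Staged.coe_rkN] at h
      exact_mod_cast h
    have hrkU : q + 3 ≤ rkN M (X ∪ Z') := by
      rw [hZ', rkN_union_filter_notMem_closure hXg hZg hZcl]
      exact hrkE
    -- `s ≥ 3`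
    have hs3 : 3 ≤ Z'.card := by
      have h1 := rkN_le_rkN_add_card_sdiff (M := M) (Finset.subset_union_left : X ⊆ X ∪ Z')
      have h2 : ((X ∪ Z') \ X).card ≤ Z'.card :=
        Finset.card_le_card (by intro z hz; rw [Finset.mem_sdiff, Finset.mem_union] at hz; exact hz.1.resolve_left hz.2)
      omega
    -- the two pair counts
    have hA := card_sub_one_le_card_pairs hXg hXr hZ'g hZ'c hs3 hrkU
    have hB := mul_le_two_mul_card_pairs hXg hXr hZ'g hZ'i hZ'c
    rw [← hPS] at hA hB
    have hmain := choose_two_le_of_pairs hq hs3 hsZ hA hB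
    -- from `C(p,2) ≤ C(q+2,2) · #PS` to the price
    have hid := choose_succ_succ_mul_choose_two p q
    have hpos : 0 < (p + q).choose q := Nat.choose_pos (by omega)
    have hpos2 : 0 < (q + 2).choose 2 := Nat.choose_pos (by omega)
    have hnat : (p + q).choose (q + 2) ≤ (p + q).choose q * PS.card := by
      have h1 : (p + q).choose (q + 2) * (q + 2).choose 2 ≤ (p + q).choose q * PS.card * (q + 2).choose 2 := by
        calc (p + q).choose (q + 2) * (q + 2).choose 2 = (p + q).choose q * p.choose 2 := hid
          _ ≤ (p + q).choose q * ((q + 2).choose 2 * PS.card) := Nat.mul_le_mul_left _ hmain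
          _ = (p + q).choose q * PS.card * (q + 2).choose 2 := by ring
      exact Nat.le_of_mul_le_mul_right h1 hpos2
    rw [div_le_iff₀ (by exact_mod_cast hpos)]
    rw [mul_comm] at hnat
    exact_mod_cast hnat
  · exact Nat.cast_nonneg _

open scoped Classical in
/-- **(T3) THE FAT SETS ARE PAID BY THE NON-CLEAN LEVEL SETS** (girth `≥ q + 1`, rank `≥ q + 3`, `q ≥ 1`):
`Σ_{B ∈ Rq, #B ≠ q} price(B) ≤ #{S : ρ(S) = q + 2, S not clean}` — each fat set is paid by its pair sets
(`price_le_card_pairs`), the pair sets of distinct fat sets are distinct (`eq_of_union_pair_eq`) and are non-clean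
level sets (`union_pair_mem_levelSet_not_clean`). -/
theorem fatIneq_of_girth {q : ℕ} (hq : 1 ≤ q) (hg : ∀ T ⊆ M.E, T.encard ≤ q → M.Indep T)
    (hrank : ((q + 3 : ℕ) : ℕ∞) ≤ M.eRank) :
    ∑ B ∈ (Profile.Rq M q).filter (fun B : Finset α => ¬ B.card = q), Profile.price M q (q + 2) B ≤
      (((Shadow.levelSet M (q + 2)).filter
        (fun S : Finset α => ¬ ∀ X ⊆ S, X.card = q + 1 → M.Indep (X : Set α))).card : ℚ) := by
  set F := (Profile.Rq M q).filter (fun B : Finset α => ¬ B.card = q) with hF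
  have hFmem : ∀ B ∈ F, B ⊆ gr M ∧ rkN M B = q ∧ q + 1 ≤ B.card := by
    intro B hB
    rw [hF, Finset.mem_filter, Profile.mem_Rq] at hB
    refine ⟨hB.1.1, ?_, ?_⟩
    · rw [Staged.rkN_eq_iff]
      exact hB.1.2
    · have h1 : rkN M B ≤ B.card := rkN_le_card B
      have h2 : rkN M B = q := by rw [Staged.rkN_eq_iff]; exact hB.1.2
      omega
  -- step 1: termwise
  have h1 : ∑ B ∈ F, Profile.price M q (q + 2) B ≤
      ∑ B ∈ F, ((((gr M \ B).powersetCard 2).filter (fun Y => rkN M (B ∪ Y) = q + 2)).card : ℚ) := by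
    apply Finset.sum_le_sum
    intro B hB
    exact price_le_card_pairs hq hrank (hFmem B hB).1 (hFmem B hB).2.1
  -- step 2: the sum of the pair counts is the cardinality of the sigma finset
  have h2 : ∑ B ∈ F, ((((gr M \ B).powersetCard 2).filter (fun Y => rkN M (B ∪ Y) = q + 2)).card : ℚ) =
      ((F.sigma (fun B => ((gr M \ B).powersetCard 2).filter (fun Y => rkN M (B ∪ Y) = q + 2))).card : ℚ) := by
    rw [Finset.card_sigma]
    push_cast
    rfl
  -- step 3: the union map is injective into the non-clean level sets
  have h3 : (F.sigma (fun B => ((gr M \ B).powersetCard 2).filter (fun Y => rkN M (B ∪ Y) = q + 2))).card ≤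
      ((Shadow.levelSet M (q + 2)).filter
        (fun S : Finset α => ¬ ∀ X ⊆ S, X.card = q + 1 → M.Indep (X : Set α))).card := by
    apply Finset.card_le_card_of_injOn (fun a : (Σ _ : Finset α, Finset α) => a.1 ∪ a.2)
    · intro a ha
      rw [Finset.mem_coe, Finset.mem_sigma] at ha
      obtain ⟨hBg, hBr, hBc⟩ := hFmem a.1 ha.1
      rw [Finset.mem_coe, Finset.mem_filter]
      exact union_pair_mem_levelSet_not_clean hBg hBr hBc ha.2
    · intro a ha a' ha' heq
      rw [Finset.mem_coe, Finset.mem_sigma] at ha ha'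
      obtain ⟨hBg, hBr, hBc⟩ := hFmem a.1 ha.1
      obtain ⟨hB'g, hB'r, hB'c⟩ := hFmem a'.1 ha'.1
      simp only at heq
      have hB : a.1 = a'.1 := eq_of_union_pair_eq hq hg hBg hB'g hBr hB'r hB'c ha.2 ha'.2 heq
      -- then the pairs agree: `Y = (B ∪ Y) \ B`
      have hYd : ∀ (B Y : Finset α), Y ∈ ((gr M \ B).powersetCard 2).filter (fun Y => rkN M (B ∪ Y) = q + 2) →
          (B ∪ Y) \ B = Y := by
        intro B Y hY
        rw [Finset.mem_filter, Finset.mem_powersetCard] at hY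
        apply Finset.union_sdiff_cancel_left
        rw [Finset.disjoint_left]
        intro z hzB hzY
        exact (Finset.mem_sdiff.1 (hY.1.1 hzY)).2 hzB
      have hY : a.2 = a'.2 := by
        rw [← hYd a.1 a.2 ha.2, ← hYd a'.1 a'.2 ha'.2, heq, hB]
      exact Sigma.ext hB (heq_of_eq hY)
  calc ∑ B ∈ F, Profile.price M q (q + 2) B
      ≤ ∑ B ∈ F, ((((gr M \ B).powersetCard 2).filter (fun Y => rkN M (B ∪ Y) = q + 2)).card : ℚ) := h1
    _ = ((F.sigma (fun B => ((gr M \ B).powersetCard 2).filter (fun Y => rkN M (B ∪ Y) = q + 2))).card : ℚ) := h2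
    _ ≤ _ := by exact_mod_cast h3

open scoped Classical in
/-- **THE ROW `(q, q+2)` OF (Π) AT GIRTH `≥ q + 1` FROM (T2′) ALONE** (rank `≥ q + 3`, `q ≥ 1`): if
`Σ_{B ∈ Rq, #B = q} price(B) ≤ #{clean (q+2)-subsets}` (the thin sets against the clean `(q+2)`-sets), then
`Profile.ProfileIneq M q (q + 2)` — the clean count (`card_clean_le_card_levelSet_clean`) and (T3) do the rest. -/
theorem profileIneq_succ_succ_of_thin {q : ℕ} (hq : 1 ≤ q) (hg : ∀ T ⊆ M.E, T.encard ≤ q → M.Indep T)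
    (hrank : ((q + 3 : ℕ) : ℕ∞) ≤ M.eRank)
    (hT2 : ∑ B ∈ (Profile.Rq M q).filter (fun B : Finset α => B.card = q), Profile.price M q (q + 2) B ≤
      ((((gr M).powersetCard (q + 2)).filter
        (fun U : Finset α => ∀ X ⊆ U, X.card = q + 1 → M.Indep (X : Set α))).card : ℚ)) :
    Profile.ProfileIneq M q (q + 2) := by
  unfold Profile.ProfileIneq
  rw [← Finset.sum_filter_add_sum_filter_not (Profile.Rq M q) (fun B : Finset α => B.card = q)]
  rw [← Finset.card_filter_add_card_filter_not
    (fun S : Finset α => ∀ X ⊆ S, X.card = q + 1 → M.Indep (X : Set α)) (s := Shadow.levelSet M (q + 2))]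
  have hcount := card_clean_le_card_levelSet_clean hg hrank
  have hcount' : ((((gr M).powersetCard (q + 2)).filter
      (fun U : Finset α => ∀ X ⊆ U, X.card = q + 1 → M.Indep (X : Set α))).card : ℚ) ≤
      (((Shadow.levelSet M (q + 2)).filter
        (fun S : Finset α => ∀ X ⊆ S, X.card = q + 1 → M.Indep (X : Set α))).card : ℚ) := by
    exact_mod_cast hcount
  have hfat := fatIneq_of_girth hq hg hrank
  push_cast
  linarith

end GirthRows

end PercRepro
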